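import Literature.NumberTheory.NumberFields.NonGaloisQuarticCMField
import Literature.NumberTheory.NumberFields.QuarticCMFieldOddRelativeClassNumberRamifiedPrime
import Literature.NumberTheory.QuadraticFields.ClassNumberOne
import HarnessLib

/-!
# The non-Galois quartic CM field `ℚ(√−(3+√2))` has even relative class number
# (Louboutin–Okazaki, *Acta Arith.* 67 (1994), §2 (5), applied to `K⁺ = ℚ(√2)`, `q = 7`)

Topic `NumberTheory/NumberFields`; namespace `Literature.NumberTheory.NumberFields.NonGaloisQuarticCM`.  Theorem-only
file (no definition, no named fact, no `sorry`): an INSTANCE of the tree's Louboutin–Okazaki theorems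
(`QuarticCMFieldOddRelativeClassNumberRamifiedPrime.lean`) on the tree's model non-Galois quartic CM field
`K = ℚ[X]/(X⁴ + 6X² + 7) ≅ ℚ(√−(3+√2))` (`NonGaloisQuarticCMField.lean`: `KD`, quartic, CM, not normal over `ℚ`).

> Louboutin–Okazaki, §2 (5): "Let `q` be the rational prime lying below the prime ideal `Q` of (4).  Then `q`
> splits in `K⁺/ℚ` and `q ≢ 3 (mod 4)`.  Hence, if `p = 2` then `q ≡ 1 (mod 8)`."

For `K = ℚ(√−(3+√2))`: `K⁺ = ℚ(√2)` (`d(K⁺) = 8`, `p = 2`), `K = K⁺(√−δ)` with `δ = 3 + √2`, `N_{K⁺/ℚ}(δ) = 7`,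
so `(δ) = Q⁺₇` is a prime of `K⁺` of norm `7`, which ramifies in `K` (`v_{Q⁺₇}(δ) = 1` is odd —
`IdealPowerOfUnramifiedRoot.lean`), and the rational prime below it is `q = 7 ≢ 1 (mod 8)`.  Hence **`h⁻_K` is
even** (`even_classNumber_div_KD`): were it odd, §2 (5) (tree
`IsCMField.mod_eight_eq_one_of_discr_eq_eight_of_not_isGalois_of_odd`) would force `7 ≡ 1 (mod 8)`.  Equivalently,
by §2 (8) in intrinsic form (tree `IsCMField.odd_classNumber_div_iff_odd_classNumber_of_not_isGalois`), **`h_K` is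
even** (`even_classNumber_KD`).  Steps typed: `√2 ∈ K⁺` (`rs_mem_maximalRealSubfield`, complex conjugation commutes
with the embeddings), `d(K⁺) = 8` (`discr_maximalRealSubfield_KD`: `disc(1, √2) = 8 = r² d(K⁺)`, tree
`QuadraticFields/ClassNumberOne.lean`, and `d(K⁺) ∈ {8} ∪ {p ≡ 1 (mod 4)}` under the odd hypothesis),
`N(3 + √2) = 7` on Bhargava's basis (`IntegralBasisConjugation.lean`), `(3 + √2)` prime and ramified in `K`.

## References

* S. Louboutin, R. Okazaki, *Determination of all non-normal quartic CM-fields and of all non-abelian normal octic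
  CM-fields with class number one*, Acta Arith. 67 (1994) 47–62, §2 (5) (held `paper:doi-10-4064-aa-67-1-47-62`,
  pp. 52–53). [LouboutinOkazaki1994]
* M. Streng, *Complex multiplication of abelian surfaces*, thesis Leiden 2010, Lemma I.3.4, Example I.7.5 (the model
  non-Galois quartic CM field; tree `NonGaloisQuarticCMField.lean`). [Streng2010]
-/

noncomputable section

open Polynomial Complex Module NumberField NumberField.IsCMField IsDedekindDomain

namespace Literature.NumberTheory.NumberFields

namespace NonGaloisQuarticCM

open Literature.NumberTheory.QuadraticFields.Quadratic

/-! ### §1. `√2 = s` lies in `K⁺`; `[K⁺ : ℚ] = 2` -/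

/-- Complex conjugation fixes `s` (`s ↦ √2 ∈ ℝ` under the embedding `a ↦ α`). [folklore] -/
private theorem complexConj_rs : IsCMField.complexConj KD rs = rs := by
  apply (emb al al_quartic).injective
  rw [IsCMField.complexEmbedding_complexConj, emb_rs, al_sq]
  have h : -(-3 - rt2) - 3 = rt2 := by ring
  rw [h, rt2, Complex.conj_ofReal]

/-- **`√2 ∈ K⁺`**: `s = −(a² + 3)`, `s² = 2`, lies in the maximal real subfield of `K = ℚ(√−(3+√2))`.
[cite: Streng2010, Example I.7.5 (K = K₀(√−(3+√2)), K₀ = ℚ(√2))] -/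
theorem rs_mem_maximalRealSubfield : rs ∈ maximalRealSubfield KD :=
  (IsCMField.complexConj_eq_self_iff KD rs).mp complexConj_rs

/-- `[K⁺ : ℚ] = 2`. [folklore] -/
private theorem finrank_maximalRealSubfield_KD : finrank ℚ (maximalRealSubfield KD) = 2 :=
  IsCMField.finrank_maximalRealSubfield_eq_two_of_finrank_eq_four KD finrank_KD

/-- `s ∉ ℚ`: no rational number maps to `s` in `K`. [folklore] -/
private theorem rs_ne_ratCast (q : ℚ) : (q : KD) ≠ rs := by
  intro h1
  apply rt2_ne_ratCast q
  have h2 := congrArg (emb al al_quartic) h1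
  rw [map_ratCast, emb_rs, al_sq] at h2
  rw [h2]; ring

/-- `s` is an algebraic integer of `K⁺`: there is `s ∈ 𝓞_{K⁺}` mapping to `s ∈ K`. [folklore] -/
private theorem exists_ringOfIntegers_coe_eq_rs :
    ∃ s : 𝓞 (maximalRealSubfield KD), ((s : maximalRealSubfield KD) : KD) = rs := by
  have hint : IsIntegral ℤ (⟨rs, rs_mem_maximalRealSubfield⟩ : maximalRealSubfield KD) :=
    ⟨X ^ 2 - C 2, monic_X_pow_sub_C _ two_ne_zero, by
      rw [Polynomial.eval₂_sub, Polynomial.eval₂_X_pow, Polynomial.eval₂_C, sub_eq_zero]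
      exact Subtype.ext rs_sq⟩
  exact ⟨⟨⟨rs, rs_mem_maximalRealSubfield⟩, hint⟩, rfl⟩

section WithS

variable {s : 𝓞 (maximalRealSubfield KD)} (hs : ((s : maximalRealSubfield KD) : KD) = rs)
include hs

/-- `s · s = 2` in `𝓞_{K⁺}`. [folklore] -/
private theorem s_mul_s : s * s = 2 := by
  apply RingOfIntegers.ext
  apply (algebraMap (maximalRealSubfield KD) KD).injective
  have h : algebraMap (maximalRealSubfield KD) KD ((s * s : 𝓞 (maximalRealSubfield KD)) : maximalRealSubfield KD) =
      rs * rs := by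
    rw [show ((s * s : 𝓞 (maximalRealSubfield KD)) : maximalRealSubfield KD) =
      (s : maximalRealSubfield KD) * (s : maximalRealSubfield KD) from rfl, map_mul]
    exact congrArg₂ (· * ·) hs hs
  rw [h, ← sq, rs_sq]
  exact (map_ofNat _ 2).symm

/-- `s² = 2` in `K⁺`. [folklore] -/
private theorem s_sq : (s : maximalRealSubfield KD) ^ 2 = 2 := by
  have h := congrArg (fun x : 𝓞 (maximalRealSubfield KD) => (x : maximalRealSubfield KD)) (s_mul_s hs)
  simp only [map_mul, map_ofNat] at h
  rw [sq, RingOfIntegers.coe_eq_algebraMap, h]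

/-- `s ∉ ℚ` inside `K⁺`. [folklore] -/
private theorem s_not_mem_range : (s : maximalRealSubfield KD) ∉ Set.range (algebraMap ℚ (maximalRealSubfield KD)) := by
  rintro ⟨q, hq⟩
  apply rs_ne_ratCast q
  have h := congrArg (algebraMap (maximalRealSubfield KD) KD) hq
  rw [← IsScalarTower.algebraMap_apply, eq_ratCast] at h
  rw [h]; exact hs

/-! ### §2. `d(K⁺) = 8` -/

/-- `disc_ℚ(1, s) = 8 = r² · d(K⁺)` for some integer `r ≠ 0`. [folklore] -/
private theorem exists_sq_mul_discr_eq_eight :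
    ∃ r : ℤ, r ≠ 0 ∧ (r : ℚ) ^ 2 * NumberField.discr (maximalRealSubfield KD) = 8 := by
  obtain ⟨r, hr0, hr⟩ := exists_discr_basisOneSqrt_eq_sq_mul_discr finrank_maximalRealSubfield_KD
    (s_not_mem_range hs) (RingOfIntegers.isIntegral_coe s)
  have hrel : (s : maximalRealSubfield KD) ^ 2 + algebraMap ℚ _ 0 * (s : maximalRealSubfield KD) +
      algebraMap ℚ _ (-2) = 0 := by
    rw [s_sq hs, map_zero, zero_mul, add_zero, map_neg, map_ofNat, add_neg_cancel]
  rw [discr_basisOneSqrt_of_quadratic finrank_maximalRealSubfield_KD (s_not_mem_range hs) hrel] at hr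
  refine ⟨r, hr0, ?_⟩
  rw [← hr]; norm_num

omit hs in
/-- **`d(K⁺) = 8`** for `K = ℚ(√−(3+√2))` with (hypothetically) odd relative class number: `d(K⁺)` is `8` or a prime
`≡ 1 (mod 4)` (Louboutin–Okazaki §2 (3)), and `r² d(K⁺) = disc(1, √2) = 8` rules the prime case out.
[cite: LouboutinOkazaki1994, §2 (3) («K⁺ = ℚ(√p) with p ≢ 3 (mod 4) a prime»)] -/
theorem discr_maximalRealSubfield_KD (hodd : Odd (classNumber KD / classNumber (maximalRealSubfield KD))) :
    NumberField.discr (maximalRealSubfield KD) = 8 := by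
  rcases IsCMField.discr_maximalRealSubfield_eq_of_not_isGalois_of_odd KD finrank_KD not_isGalois_KD hodd with
    h8 | ⟨hp, h1⟩
  · exact h8
  · exfalso
    obtain ⟨s, hs⟩ := exists_ringOfIntegers_coe_eq_rs
    obtain ⟨r, hr0, hr⟩ := exists_sq_mul_discr_eq_eight hs
    set d := NumberField.discr (maximalRealSubfield KD) with hd
    have hrd : r ^ 2 * d = 8 := by exact_mod_cast hr
    have hdvd : d ∣ 2 ^ 3 := ⟨r ^ 2, by linarith [hrd]⟩
    have hd2 : d ∣ 2 := hp.dvd_of_dvd_pow hdvd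
    have hle : d.natAbs ∣ 2 := by
      have := Int.natAbs_dvd_natAbs.mpr hd2
      simpa using this
    have hle' : d.natAbs ≤ 2 := Nat.le_of_dvd two_pos hle
    have hne1 : d ≠ 1 := fun h => hp.ne_one h
    omega

/-! ### §3. `δ = 3 + √2`: norm `7`, `(δ)` a prime `Q⁺₇` of `K⁺` above `7`, `−δ = a²` in `𝓞_K` -/

/-- **`N_{K⁺/ℚ}(3 + √2) = 7`** (on Bhargava's basis `(1, τ)` of `𝓞_{ℚ(√2)}`, `τ = ±√2`: `N(u + vτ) = u² − 2v²`).
[cite: LouboutinOkazaki1994, §2 (5) (N_{K⁺/ℚ}(δ⁺))] -/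
theorem norm_three_add (hodd : Odd (classNumber KD / classNumber (maximalRealSubfield KD))) :
    Algebra.norm ℤ (3 + s) = 7 := by
  have h2F := finrank_maximalRealSubfield_KD
  obtain ⟨T⟩ := nonempty_tauData h2F
  have hdisc := T.discr_eq
  rw [discr_maximalRealSubfield_KD hodd] at hdisc
  have hε : T.ε = 0 := by rcases T.ε_eq with h | h <;> omega
  have hm : T.m = 2 := by omega
  have hτ : T.τ * T.τ = 2 := by
    rw [T.τ_sq, hm, hε]; push_cast; ring
  -- `s = ±τ`
  have hst : (s - T.τ) * (s + T.τ) = 0 := by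
    have h := s_mul_s hs
    linear_combination h - hτ
  rcases mul_eq_zero.mp hst with h | h
  · have hx : (3 + s : 𝓞 (maximalRealSubfield KD)) = ((3 : ℤ) : 𝓞 _) + ((1 : ℤ) : 𝓞 _) * T.τ := by
      rw [sub_eq_zero.mp h]; push_cast; ring
    rw [norm_eq_of_tauData_coords h2F T hx, hε, hm]; norm_num
  · have hx : (3 + s : 𝓞 (maximalRealSubfield KD)) = ((3 : ℤ) : 𝓞 _) + ((-1 : ℤ) : 𝓞 _) * T.τ := by
      rw [eq_neg_of_add_eq_zero_left h]; push_cast; ring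
    rw [norm_eq_of_tauData_coords h2F T hx, hε, hm]; norm_num

/-- `(3 + √2)` has absolute norm `7`. [folklore] -/
private theorem absNorm_span_three_add (hodd : Odd (classNumber KD / classNumber (maximalRealSubfield KD))) :
    Ideal.absNorm (Ideal.span {(3 + s : 𝓞 (maximalRealSubfield KD))}) = 7 := by
  rw [Ideal.absNorm_span_singleton, norm_three_add hs hodd]; rfl

/-- `(3 + √2)` is a prime ideal of `𝓞_{K⁺}`. [folklore] -/
private theorem isPrime_span_three_add (hodd : Odd (classNumber KD / classNumber (maximalRealSubfield KD))) :
    (Ideal.span {(3 + s : 𝓞 (maximalRealSubfield KD))}).IsPrime :=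
  Ideal.isPrime_of_irreducible_absNorm (by rw [absNorm_span_three_add hs hodd]; exact (by norm_num : Nat.Prime 7))

/-- `(3 + s) ≠ 0` (`s = −3` would give `s² = 9 ≠ 2`). [folklore] -/
private theorem span_three_add_ne_bot : Ideal.span {(3 + s : 𝓞 (maximalRealSubfield KD))} ≠ ⊥ := by
  rw [Ne, Ideal.span_singleton_eq_bot]
  intro h0
  have h1 : s = -3 := by linear_combination h0
  have h2 := s_mul_s hs
  rw [h1] at h2
  norm_num at h2

/-- `7 ∈ (3 + √2)`: `7 = (3 + √2)(3 − √2)`. [folklore] -/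
private theorem seven_mem_span_three_add : ((7 : ℕ) : 𝓞 (maximalRealSubfield KD)) ∈
    Ideal.span {(3 + s : 𝓞 (maximalRealSubfield KD))} := by
  refine Ideal.mem_span_singleton'.mpr ⟨3 - s, ?_⟩
  have h := s_mul_s hs
  push_cast
  linear_combination (-1 : 𝓞 (maximalRealSubfield KD)) * h

omit hs in
/-- `a` is an algebraic integer (`a² = −3 − s`, `s² = 2`): there is `a ∈ 𝓞_K` mapping to the generator. [folklore] -/
private theorem exists_ringOfIntegers_coe_eq_ra : ∃ a : 𝓞 KD, (a : KD) = ra := by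
  have hrs : IsIntegral ℤ rs := ⟨X ^ 2 - C 2, monic_X_pow_sub_C _ two_ne_zero, by simp [rs_sq]⟩
  have h3 : IsIntegral ℤ (3 : KD) := by
    rw [show (3 : KD) = algebraMap ℤ KD 3 by simp]; exact isIntegral_algebraMap
  have hra2 : ra ^ 2 = -(3 + rs) := by simp only [rs]; ring
  have hint : IsIntegral ℤ ra := IsIntegral.of_pow two_pos (by rw [hra2]; exact (h3.add hrs).neg)
  exact ⟨⟨ra, hint⟩, rfl⟩

/-- `−δ = a²` in `𝓞_K` (`δ = 3 + s = −a²`). [folklore] -/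
private theorem algebraMap_neg_three_add {a : 𝓞 KD} (ha : (a : KD) = ra) :
    algebraMap (𝓞 (maximalRealSubfield KD)) (𝓞 KD) (-(3 + s)) = a ^ 2 := by
  apply RingOfIntegers.ext
  simp only [map_neg, map_add, map_ofNat, map_pow]
  have h1 : algebraMap (𝓞 KD) KD (algebraMap (𝓞 (maximalRealSubfield KD)) (𝓞 KD) s) = rs := by
    rw [← IsScalarTower.algebraMap_apply,
      IsScalarTower.algebraMap_apply (𝓞 (maximalRealSubfield KD)) (maximalRealSubfield KD) KD]
    exact hs
  have h2 : algebraMap (𝓞 KD) KD a = ra := ha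
  rw [h1, h2]; simp only [rs]; ring

/-- **The prime `Q⁺₇ = (3 + √2)` of `K⁺` ramifies in `K = K⁺(√−(3+√2))`**: `v_{Q⁺₇}(3 + √2) = 1` is odd, whereas at
a prime unramified in `K` the exponent of `−δ = a²` would be even. [cite: LouboutinOkazaki1994, §2 (4) (proof: «if a
prime ideal L of K⁺ is such that the exact power of L that divides the ideal (δ) is odd, then L is ramified in
K/K⁺»)] -/
theorem not_isUnramifiedIn_span_three_add (hodd : Odd (classNumber KD / classNumber (maximalRealSubfield KD))) :
    ¬ Algebra.IsUnramifiedIn (𝓞 KD) (Ideal.span {(3 + s : 𝓞 (maximalRealSubfield KD))}) := by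
  intro hunr
  obtain ⟨a, ha⟩ := exists_ringOfIntegers_coe_eq_ra
  set v : HeightOneSpectrum (𝓞 (maximalRealSubfield KD)) :=
    ⟨Ideal.span {(3 + s : 𝓞 (maximalRealSubfield KD))}, isPrime_span_three_add hs hodd,
      span_three_add_ne_bot hs⟩ with hv
  have hne : (-(3 + s) : 𝓞 (maximalRealSubfield KD)) ≠ 0 := by
    rw [neg_ne_zero]
    intro h0
    exact span_three_add_ne_bot hs (Ideal.span_singleton_eq_bot.mpr h0)
  have h := dvd_count_of_eq_pow_of_isUnramifiedIn hne (algebraMap_neg_three_add hs ha) v hunr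
  rw [Ideal.span_singleton_neg, Associates.count_self v.associates_irreducible] at h
  omega

/-- With `K = ℚ(√−(3+√2))`, `s = √2 ∈ 𝓞_{K⁺}`: **if `h⁻_K` were odd, then `7 ≡ 1 (mod 8)`** — §2 (5) at `K⁺ = ℚ(√2)`,
`Q⁺ = (3 + √2)`, `q = 7`. [cite: LouboutinOkazaki1994, §2 (5) («if p = 2 then q ≡ 1 (mod 8)»)] -/
theorem seven_mod_eight_of_odd (hodd : Odd (classNumber KD / classNumber (maximalRealSubfield KD))) : 7 % 8 = 1 :=
  IsCMField.mod_eight_eq_one_of_discr_eq_eight_of_not_isGalois_of_odd KD finrank_KD not_isGalois_KD hodd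
    (discr_maximalRealSubfield_KD hodd)
    (v₀ := ⟨_, isPrime_span_three_add hs hodd, span_three_add_ne_bot hs⟩)
    (not_isUnramifiedIn_span_three_add hs hodd) (by norm_num : Nat.Prime 7) (seven_mem_span_three_add hs)

end WithS

/-! ### §4. The relative class number of `ℚ(√−(3+√2))` is even -/

/-- **`ℚ(√−(3+√2))` has even relative class number `h⁻ = h_K/h_{K⁺}`**: with `K⁺ = ℚ(√2)` (`p = 2`) the ramified
prime `Q⁺₇ = (3 + √2)` lies above `q = 7 ≢ 1 (mod 8)`, contradicting «if `p = 2` then `q ≡ 1 (mod 8)`» for an odd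
relative class number. [cite: LouboutinOkazaki1994, §2 (5) («if p = 2 then q ≡ 1 (mod 8)»), applied to K = ℚ(√−(3+√2)), K⁺ = ℚ(√2), q = 7] -/
theorem even_classNumber_div_KD : Even (classNumber KD / classNumber (maximalRealSubfield KD)) := by
  by_contra hne
  rw [Nat.not_even_iff_odd] at hne
  obtain ⟨s, hs⟩ := exists_ringOfIntegers_coe_eq_rs
  have h := seven_mod_eight_of_odd hs hne
  norm_num at h

/-- **`ℚ(√−(3+√2))` has even class number** (`h⁻_K` odd ⟺ `h_K` odd for a non-normal quartic CM field, §2 (3)/(8)).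
[cite: LouboutinOkazaki1994, §2 (5) and (8)] -/
theorem even_classNumber_KD : Even (classNumber KD) := by
  by_contra hne
  rw [Nat.not_even_iff_odd] at hne
  exact (Nat.not_even_iff_odd.mpr ((IsCMField.odd_classNumber_div_iff_odd_classNumber_of_not_isGalois KD
    finrank_KD not_isGalois_KD).mpr hne)) even_classNumber_div_KD

end NonGaloisQuarticCM

end Literature.NumberTheory.NumberFields
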